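import Mathlib
import Summits.QuantumFields.YangMills.Theses.FlatTubeReduction
import Summits.QuantumFields.YangMills.Theorems.FlatTubeReductionPinnedOfNearFlat

/-!
# SKELETON «via-k1» for the crux K1a′ `PinnedTubeRatioLawW` (stmt-QuantumFields-27141, route `FlatTubeReduction`) — ONE STUB: K1 `NearFlatRatioLaw`
# (registered item stmt-QuantumFields-24720) BY NAME

Seat `ym-line-ftr-p1` g6 (2026-08-28).  K1a′ is K1's ratio law restricted to `L ≥ 2` and to Polyakov-PINNED tube states, with one extra existential
`κ ∈ (14/51, 1/3)` that occurs only in the (additional) pinning hypothesis; so K1 ⇒ K1a′ by discarding that hypothesis (landed: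
`FlatTubeReduction.pinnedTubeRatioLawW_of_nearFlatRatioLaw`, p629596), and K1a′ ⇒ K1 is the landed dichotomy glue
`nearFlatRatioLaw_of_pinnedTubeRatioLaw_window` (p617122) — the two items are EQUIVALENT modulo landed glue
(`FlatTubeReduction.nearFlatRatioLaw_iff_pinnedTubeRatioLawW`).  Hence the line of record for 27141 is: K1a′ ⇐ K1 ⇐ `stub_boRate` (K1's registered
skeleton «borate» = the FCL crux 23943's single stub, pooled with route RED lane A's C4-CORE) — ONE obligation for 23943, 24720 and 27141
(`FlatTubeReduction.pinnedTubeRatioLawW_of_boRate`).  A seat that prefers to attack the PINNED Born–Oppenheimer regime directly (Lüscher's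
non-degenerate regime, the planner's original intent for K1a/K1a′) re-registers its own skeleton here; nothing in this file constrains that.
HONEST FRAMING: by-name glue; K1 is OPEN fixed-lattice semiclassics (XL); femto rung R2b1 (RECORD label) — not infinite volume, not a mass gap, not Clay.
No summit is proved by this line.
-/

set_option autoImplicit false

noncomputable section

open Summit.QuantumFields.YangMills.Theorems.FlatTubeReduction
open Summit.QuantumFields.YangMills.Theses.FlatTubeReduction

namespace Summit.QuantumFields.YangMills.Cruxes.PinnedTubeRatioLawW.ViaK1

/-- stub (the ONLY one): K1 `NearFlatRatioLaw` — the registered item stmt-QuantumFields-24720 BY NAME (its own skeleton «borate» has the single stub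
`stub_boRate`, pooled with FCL 23943 / RED lane A C4-CORE). -/
theorem stub_nearFlatRatioLaw : NearFlatRatioLaw := by
  sorry

/-- ★ The crux BY NAME from exactly the one declared stub, through the landed `pinnedTubeRatioLawW_of_nearFlatRatioLaw` (p629596). -/
theorem PinnedTubeRatioLawW_holds_of_stubs : Summit.QuantumFields.YangMills.Theses.FlatTubeReduction.PinnedTubeRatioLawW :=
  pinnedTubeRatioLawW_of_nearFlatRatioLaw stub_nearFlatRatioLaw

end Summit.QuantumFields.YangMills.Cruxes.PinnedTubeRatioLawW.ViaK1

end
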